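import Summits.Schanuel.Schanuel.Theorems.DiophantineDichotomyKhovanskiiApproxTypeEvRaceLiminf
import Summits.Schanuel.Schanuel.Theorems.DiophantineDichotomyKhovanskiiApproxTypeEvLogBarrier
import Summits.Schanuel.Schanuel.Theorems.EPiSimultaneousType.Negative.OfKhovanskiiApproxType
import Summits.Schanuel.Schanuel.Theorems.RoyCriterionSchanuelTwoLineSketch
import HarnessLib

/-!
# Route `DiophantineDichotomy`, crux `KhovanskiiApproxTypeEv` (stmt-Schanuel-14972):
# the minimal race input is NOT easier than Schanuel pointwise (honesty caveat R2 for R4)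

Companion of `Theorems/DiophantineDichotomyKhovanskiiApproxTypeEvRaceLiminf.lean` (vocabulary
`RaceInputAt` / `KhovanskiiRaceInput` in `…KhovanskiiApproxTypeEvDefs.lean`, namespace
`…KhovanskiiApproxTypeEv.RaceInput`).  There the liminf / single-level input was shown to be implied
by the crux as filed and still race-sufficient.  Here: what it still CONTAINS.

## Contents (all implications; nothing is credited to the summit)

* `two_le_trdeg_of_raceInputAt` — at ANY `θ = (s, e^s)`, `n ≥ 2`, `s` `ℚ`-linearly independent,
  `RaceInputAt n s` alone forces `2 ≤ trdeg_ℚ ℚ(s, e^s)`: the one-level engine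
  `race_at_one_level` run with the PROVED level-one approximation property
  `approximationPropertyDegOne_proof` (Diaz 1997 = Bugeaud 2004 Thm 8.11 + Roy–Waldschmidt lifting)
  and the exponent comparison `D^{1/(n−1)} ≤ D`.
* `khovanskiiSchanuel_two_of_raceInput` — hence `KhovanskiiRaceInput` gives Schanuel at every free
  Khovanskii point of `ℂ²` OUTRIGHT (no approximation-property hypothesis).
* `barriers_of_khovanskiiRaceInput : KhovanskiiRaceInput → e ⊥ π ∧ πi ⊥ log 2 ∧ log 2 ⊥ log 3` —
  the one-name certificate for the planners (analogue of `barriers_of_khovanskiiApproxTypeEv`,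
  p125943): the liminf restatement does not leave the catalogued barriers
  (`Literature.NumberTheory.Transcendental.ExpOnePiAlgebraicIndependent`,
  `Literature.Barriers.Schanuel.AlgebraicIndependenceOfLogarithms`); it is only the honest MINIMUM
  of what the route asserts beyond Schanuel (its surplus: "θ is not a simultaneous U-point along
  some sequence of degrees").
-/

noncomputable section

-- `Summit.Schanuel.Schanuel.…` is the mandated summit/sub-problem namespace (single-conjunct summit), hence:
set_option linter.dupNamespace false

namespace Summit.Schanuel.Schanuel.Cruxes.KhovanskiiApproxTypeEv.RaceInput

open Summit.Schanuel.Schanuel.Theses.DiophantineDichotomy (ApproximationPropertyDegOne)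
open Summit.Schanuel.Schanuel.Cruxes.KhovanskiiApproxType.LwSmallHeight (IsFreeKhovanskii)
open Summit.Schanuel.Schanuel.Cruxes.KhovanskiiApproxTypeEv.AnchoredReduction
  (isFreeKhovanskii_piI_logTwo isFreeKhovanskii_logTwo_logThree linearIndependent_log_two_log_three
    trdeg_adjoin_eq_of_exp_algebraic exp_pi_I)
open Summit.Schanuel.Schanuel.Theorems
  (approximationPropertyDegOne_proof expOnePiAlgebraicIndependent_of_two_le_trdeg
    ApproximationRace.le_pred_of_lt_natCast EPiSimultaneousType.linearIndependent_one_I_pi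
    EPiSimultaneousType.khovanskiiSystem_one_I_pi)
open Summit.Schanuel.Schanuel.Theorems.AclSubsetLogFreeCore.Negative (exp_log_two exp_log_three)
open Literature.Barriers.Schanuel
  (linearIndependent_piI_log_two algebraicIndependent_of_le_trdeg_adjoin)
open Complex

/-! ## Honesty caveat (R2 for R4): the minimal input still forces `trdeg ≥ 2` pointwise -/

/-- **Level-one race from the minimal input.**  At `θ = (s, e^s) ∈ ℂ²ⁿ` with `n ≥ 2` and `s`
`ℚ`-linearly independent, `RaceInputAt n s` alone gives `2 ≤ trdeg_ℚ ℚ(s, e^s)`: otherwise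
`trdeg ≤ 1` and the PROVED level-one approximation property `approximationPropertyDegOne_proof`
(Diaz 1997 = Bugeaud 2004 Thm 8.11 + Roy–Waldschmidt lifting) has constant `c` at `θ`; the input
with `ε := 1/(2c²)` supplies a level `D ≥ c²` whose measure has exponent
`D^{1/(n−1)}/(2c²) ≤ D/(2c²)`, and `race_at_one_level` (with `t = 1`) finishes.  So the liminf
restatement is NOT easier than the Schanuel-type statement it produces, at any point. [folklore] -/
theorem two_le_trdeg_of_raceInputAt {n : ℕ} {s : Fin n → ℂ} (hn : 2 ≤ n)
    (hs : LinearIndependent ℚ s) (hRI : RaceInputAt n s) :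
    (2 : Cardinal) ≤ Algebra.trdeg ℚ
      ↥(IntermediateField.adjoin ℚ (Set.range s ∪ Set.range (Complex.exp ∘ s))) := by
  by_contra hlt
  rw [not_le] at hlt
  have key : ∀ S : Set ℂ, S = Set.range s ∪ Set.range (Complex.exp ∘ s) →
      Algebra.trdeg ℚ ↥(IntermediateField.adjoin ℚ S) ≤ 1 := by
    rintro S rfl
    have h := ApproximationRace.le_pred_of_lt_natCast (n := 2) (by omega) (by exact_mod_cast hlt)
    simpa using h
  obtain ⟨c, hc1, hAP'⟩ := approximationPropertyDegOne_proof (Fin n ⊕ Fin n)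
    (Sum.elim s (Complex.exp ∘ s)) (key _ (Set.Sum.elim_range _ _))
  have hcpos : (0 : ℝ) < c := lt_of_lt_of_le one_pos hc1
  have hε : (0 : ℝ) < 1 / (2 * c ^ 2) := by positivity
  obtain ⟨D, hD₀, κ, Hm, hmeas⟩ := hRI (1 / (2 * c ^ 2)) hε (⌈c ^ 2⌉₊ + 1)
  have hD1 : 1 ≤ D := le_trans (Nat.le_add_left 1 _) hD₀
  have hD1' : (1 : ℝ) ≤ D := by exact_mod_cast hD1
  have hDge : (c ^ 2) ^ 1 ≤ (D : ℝ) := by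
    rw [pow_one]
    have h1 : (c ^ 2 : ℝ) ≤ ⌈c ^ 2⌉₊ := Nat.le_ceil _
    have h2 : ((⌈c ^ 2⌉₊ : ℕ) : ℝ) ≤ D := by exact_mod_cast le_trans (Nat.le_succ _) hD₀
    exact h1.trans h2
  -- the exponent `D^{1/(n−1)} ≤ D = D^{1/1}`
  have hexp : (D : ℝ) ^ (1 / ((n : ℝ) - 1)) ≤ (D : ℝ) ^ (1 / ((1 : ℕ) : ℝ)) := by
    refine Real.rpow_le_rpow_of_exponent_le hD1' ?_
    have hn1 : (1 : ℝ) ≤ (n : ℝ) - 1 := by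
      have : (2 : ℝ) ≤ n := by exact_mod_cast hn
      linarith
    rw [Nat.cast_one, div_one]
    exact (div_le_one (by linarith)).mpr hn1
  refine race_at_one_level (exists_transcendental_coord (by omega) hs) hc1 le_rfl
    (fun Δ Y hcΔ hΔY => ?_) hDge (κ := κ) (Hm := Hm) fun H γ hH hfin hpoly => ?_
  · obtain ⟨γ, d, H, hfin, hpoly, hdcap, -, hdist⟩ := hAP' Δ Y hcΔ hΔY
    exact ⟨γ, d, H, hfin, hpoly, by rw [pow_one]; exact hdcap, hdist⟩
  · refine le_trans (Real.exp_le_exp.mpr ?_) (hmeas H γ hH ⟨hfin, hpoly⟩)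
    rw [neg_le_neg_iff]
    have hlog : 0 ≤ Real.log H := Real.log_natCast_nonneg H
    have h1 : 1 / (2 * c ^ 2) * (D : ℝ) ^ (1 / ((n : ℝ) - 1)) ≤
        1 / (2 * c ^ 2) * (D : ℝ) ^ (1 / ((1 : ℕ) : ℝ)) :=
      mul_le_mul_of_nonneg_left hexp hε.le
    nlinarith [mul_le_mul_of_nonneg_right h1 hlog]

/-- **At rank 2 the restated input gives Schanuel at free Khovanskii points OUTRIGHT** (no
approximation-property hypothesis: the level-one property is proved): `KhovanskiiRaceInput` ⇒
`trdeg_ℚ ℚ(s, e^s) ≥ 2` for every `ℚ`-linearly independent free Khovanskii `s ∈ ℂ²`.  At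
`(1, iπ)` this is `e ⊥ π`, at `(πi, log 2)` and `(log 2, log 3)` two algebraically independent
logarithms — see `barriers_of_khovanskiiRaceInput`. [folklore] -/
theorem khovanskiiSchanuel_two_of_raceInput (hRI : KhovanskiiRaceInput) (s : Fin 2 → ℂ)
    (hs : LinearIndependent ℚ s) (hfree : IsFreeKhovanskii 2 s) :
    (2 : Cardinal) ≤ Algebra.trdeg ℚ
      ↥(IntermediateField.adjoin ℚ (Set.range s ∪ Set.range (Complex.exp ∘ s))) :=
  two_le_trdeg_of_raceInputAt le_rfl hs (hRI 2 s le_rfl hs hfree)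

/-- **Registered sub-goal `barriers_of_khovanskiiRaceInput` — the restatement does not leave the
catalogued barriers** (one-name certificate for the planners, the analogue of
`barriers_of_khovanskiiApproxTypeEv` p125943 for the liminf input):
`KhovanskiiRaceInput` implies the algebraic independence of `e` and `π`
(`Literature.NumberTheory.Transcendental.ExpOnePiAlgebraicIndependent`, barrier
`LargeTranscendenceDegree` territory), of `πi` and `log 2`, and of `log 2` and `log 3` (barrier
`Literature.Barriers.Schanuel.AlgebraicIndependenceOfLogarithms`: no two algebraically independent
logarithms of algebraic numbers are known).  Proof: `khovanskiiSchanuel_two_of_raceInput` at the free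
Khovanskii points `(1, iπ)`, `(πi, log 2)`, `(log 2, log 3)` (systems landed in
`EPiSimultaneousType.khovanskiiSystem_one_I_pi`, `isFreeKhovanskii_piI_logTwo`,
`isFreeKhovanskii_logTwo_logThree`) and the landed conversions
`expOnePiAlgebraicIndependent_of_two_le_trdeg`, `trdeg_adjoin_eq_of_exp_algebraic`,
`algebraicIndependent_of_le_trdeg_adjoin`. [folklore] -/
theorem barriers_of_khovanskiiRaceInput : KhovanskiiRaceInput →
    Literature.NumberTheory.Transcendental.ExpOnePiAlgebraicIndependent ∧
      AlgebraicIndependent ℚ ![(Real.pi : ℂ) * Complex.I, (Real.log 2 : ℂ)] ∧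
      AlgebraicIndependent ℚ ![(Real.log 2 : ℂ), (Real.log 3 : ℂ)] := by
  intro hRI
  refine ⟨?_, ?_, ?_⟩
  · -- the flagship point `(1, iπ)`
    have h2 := khovanskiiSchanuel_two_of_raceInput hRI ![(1 : ℂ), I * Real.pi]
      EPiSimultaneousType.linearIndependent_one_I_pi EPiSimultaneousType.khovanskiiSystem_one_I_pi
    have hsw : (![(1 : ℂ), I * Real.pi] : Fin 2 → ℂ) = ![(1 : ℂ), (Real.pi : ℂ) * I] := by
      rw [mul_comm]
    rw [hsw] at h2
    exact expOnePiAlgebraicIndependent_of_two_le_trdeg h2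
  · -- the log point `(πi, log 2)`: `e^{πi} = -1`, `e^{log 2} = 2` are algebraic
    set s : Fin 2 → ℂ := ![(Real.pi : ℂ) * I, (Real.log 2 : ℂ)] with hs
    have halg : ∀ i, IsAlgebraic ℚ (Complex.exp (s i)) := by
      intro i
      fin_cases i
      · simp only [hs, Fin.zero_eta, Fin.isValue, Matrix.cons_val_zero, exp_pi_I]
        simpa using isAlgebraic_algebraMap (R := ℚ) (A := ℂ) (-1)
      · simp only [hs, Fin.mk_one, Fin.isValue, Matrix.cons_val_one, Matrix.cons_val_fin_one,
          exp_log_two]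
        simpa using isAlgebraic_algebraMap (R := ℚ) (A := ℂ) 2
    have h2 := khovanskiiSchanuel_two_of_raceInput hRI s
      Literature.Barriers.Schanuel.linearIndependent_piI_log_two isFreeKhovanskii_piI_logTwo
    rw [trdeg_adjoin_eq_of_exp_algebraic s halg] at h2
    exact algebraicIndependent_of_le_trdeg_adjoin s (by exact_mod_cast h2)
  · -- the log point `(log 2, log 3)`
    set s : Fin 2 → ℂ := ![(Real.log 2 : ℂ), (Real.log 3 : ℂ)] with hs
    have halg : ∀ i, IsAlgebraic ℚ (Complex.exp (s i)) := by
      intro i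
      fin_cases i
      · simp only [hs, Fin.zero_eta, Fin.isValue, Matrix.cons_val_zero, exp_log_two]
        simpa using isAlgebraic_algebraMap (R := ℚ) (A := ℂ) 2
      · simp only [hs, Fin.mk_one, Fin.isValue, Matrix.cons_val_one, Matrix.cons_val_fin_one,
          exp_log_three]
        simpa using isAlgebraic_algebraMap (R := ℚ) (A := ℂ) 3
    have h2 := khovanskiiSchanuel_two_of_raceInput hRI s
      linearIndependent_log_two_log_three isFreeKhovanskii_logTwo_logThree
    rw [trdeg_adjoin_eq_of_exp_algebraic s halg] at h2
    exact algebraicIndependent_of_le_trdeg_adjoin s (by exact_mod_cast h2)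

end Summit.Schanuel.Schanuel.Cruxes.KhovanskiiApproxTypeEv.RaceInput

end
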